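import Mathlib.Analysis.SpecialFunctions.Exp
import Mathlib.Analysis.Normed.Field.Basic
import Mathlib.Algebra.BigOperators.Group.Finset.Powerset
import Mathlib.Data.Finset.Interval
import Mathlib.Data.Nat.Choose.Sum
import Mathlib.MeasureTheory.Integral.IntervalIntegral.FundThmCalculus
import Mathlib.Analysis.Complex.RealDeriv
import Mathlib.Analysis.Calculus.Deriv.Pow
import Mathlib.Analysis.Calculus.MeanValue
import Mathlib.Analysis.SpecialFunctions.ExpDeriv
import Mathlib.Topology.Algebra.InfiniteSum.Real
import HarnessLib
import Literature.Probability.LatticeModels.PolymerGas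

/-!
# Cluster expansion of abstract polymer gases: the Kotecký–Preiss condition, zero-freeness, `log Z`, truncated functionals

Trunk T-STATMECH (`Probability/LatticeModels`), a second layer on top of
`Literature.Probability.LatticeModels.PolymerGas`, whose vocabulary is used throughout: a set `P`
of polymers with an *incompatibility* relation `inc` (`γ ι γ'`; reflexive and symmetric where
stated, as in [KP86, §2]: hypotheses `[Std.Refl inc]`, `[Std.Symm inc]`), complex activities
`w : P → ℂ` (a polymer functional `Φ`), compatible families `IsCompatible inc X` and the partition
function `polymerPartitionFunction inc w Λ = ∑_{X ⊆ Λ compatible} ∏_{γ ∈ X} w γ` of a finite set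
`Λ` of polymers ([KP86, §2]; Friedli–Velenik Def. 5.2 with the hard-core interactions of §5.6),
with its one-polymer recursion `polymerPartitionFunction_insert` / `_eq_erase_add` from that file.
This is the abstract layer of the high-temperature (strong coupling) expansion of lattice gauge
theory (Osterwalder–Seiler 1978, Seiler LNP 159 Ch. 3), used for `constructive-qft.S14`.

What this file adds to `PolymerGas` (Dobrushin's criterion `polymerPartitionFunction_ne_zero_and_ratio_le`,
stated with a weight `μ`): the bounds are organised around the Kotecký–Preiss size function `a`
(`kpTerm w a γ = ‖w γ‖ e^{a γ}`; the zero-freeness below is the special case `1 + x ≤ e^{x}` of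
Dobrushin's criterion, re-derived in two-sided form because the lower ratio bound and the bound
`‖Z(Λ)/Z(Λ ∖ γ) - 1‖ ≤ x e^{-x}` are what the `log Z` layer needs), and the `log Z` / truncated
functional layer of [KP86] with its named estimate (4).

## Main results (all proved except the one named fact)

* `polymerPartitionFunction_eq_sdiff_add_sum`: deletion of a clique of pairwise incompatible
  polymers, `Z(Λ) = Z(Λ ∖ D) + ∑_{γ ∈ D} w γ · Z({γ' ∈ Λ ∖ D | ¬ γ ι γ'})`;
  `polymerPartitionFunction_union_of_forall_not`: factorisation `Z(A ∪ B) = Z(A) Z(B)` over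
  mutually compatible parts.
* `polymerPartitionFunction_kp_bounds`, `polymerPartitionFunction_ne_zero_of_kp`,
  `norm_polymerPartitionFunction_sdiff_div_le_of_kp`, `le_norm_polymerPartitionFunction_sdiff_div_of_kp`:
  under the finite-volume **Kotecký–Preiss condition** `IsKPVolume`
  (`∑_{γ' ∈ Λ, γ' ι γ} ‖w γ'‖ e^{a γ'} ≤ a γ` for `γ ∈ Λ`; [KP86, (1)] with `d = 0`,
  Friedli–Velenik (5.10)) every `Z(Λ')`, `Λ' ⊆ Λ`, is **non-zero** ([KP86, Theorem]) and
  `e^{-x_γ} ≤ ‖Z(Λ' ∖ γ)/Z(Λ')‖ ≤ e^{x_γ}`, `‖Z(Λ')/Z(Λ' ∖ γ) - 1‖ ≤ x_γ e^{-x_γ}`,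
  `x_γ = ‖w γ‖ e^{a γ}`; telescoped: `e^{-∑_D x} ≤ ‖Z(Λ' ∖ D)/Z(Λ')‖ ≤ e^{∑_D x}`. The proof is
  the Dobrushin-type induction on `|Λ'|` (cf. [FLP20] and `PolymerGas`): with
  `u = w γ Z(F)/Z(Λ' ∖ γ)` one gets `‖u‖ ≤ x_γ e^{-x_γ} < 1` from the induction hypothesis and
  the KP condition at `γ`, and `1/(1 - x e^{-x}) ≤ e^{x}` is `1 + x ≤ e^{x}`.
  `sum_kpTerm_le_sum_of_incompatible`: the KP condition bounds `∑_{γ' ∈ D} x_{γ'}` by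
  `∑_{γ ∈ Δ} a γ` when every polymer of `D` is incompatible with one of `Δ`.
* `polymerLogZ`: the Kotecký–Preiss branch of `log Z(Λ; w)` — the continuous branch along the
  segment `t ↦ t • w`, normalised at `t = 0`, written `∫₀¹ Z'(t)/Z(t) dt`
  (`polymerRayDeriv` is `Z'`); `exp_polymerLogZ(_of_kp)`: it is a logarithm of `Z` when
  `Z(Λ; t w) ≠ 0` on `[0,1]` (KP case); `polymerLogZ_union_of_forall_not`: additivity over
  mutually compatible parts.
* `truncatedWeight` (`Φ^T`, [KP86, (3)]), the Möbius transform of `log Z`;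
  `polymerLogZ_eq_sum_truncatedWeight` ([KP86, (2)], Boolean Möbius inversion
  `sum_powerset_sum_powerset_neg_one_pow_card_sdiff_mul`);
  `truncatedWeight_eq_zero_of_kp`: `Φ^T(C) = 0` unless `C` is a cluster (`IsPolymerCluster`,
  [KP86, Theorem]); `polymerPartitionFunction_sdiff_div_eq_exp`:
  `Z(Λ ∖ D)/Z(Λ) = exp(-∑_{C ⊆ Λ, C ∩ D ≠ ∅} Φ^T(C))` (the general form of [KP86, (5)], which is
  the case of the polymers incompatible with a fixed compatible family).
* `polymerPartitionFunction_image`, `polymerLogZ_image`, `truncatedWeight_image`: invariance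
  under injective relabelings respecting activities and incompatibility (so that clusters of
  different volumes / lattices can be identified).
* `koteckyPreiss_truncatedWeight_bound` — **named fact** [KP86, Theorem p. 492, estimate (4)]:
  for `inc` reflexive and symmetric, under (1), `∑_{C ι γ} |Φ^T(C)| e^{d(C)} ≤ a(γ)`
  (`KPTouches inc C γ` is `C ι γ`). Consequences proved from it: `norm_sum_truncatedWeight_le`
  (the cluster sum of a ratio is `≤ ∑_{γ ∈ D} a γ`, uniformly in the volume),
  `sum_norm_truncatedWeight_le_exp_neg_mul` and the `KPTouches` forms
  `sum_norm_truncatedWeight_*_of_touches` (clusters through `γ` of `d`-size `≥ r` weigh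
  `≤ e^{-r} a(γ)`), the inputs for thermodynamic limits and exponential clustering.

Relation to the other files of the directory: `kpTerm w a` is the summand of [KP86, (1)]
(`‖w γ‖ e^{a γ}`), not the Dobrushin weight `μ`; for the geometric weight
`PolymerGasGeometric.kpWeight R λ X = λ^{#X}` (on `R`-connected `X`) and `a X = #X` one has
`kpTerm w (fun X => #X) X ≤ kpWeight R (e ε) X` when `‖w X‖ ≤ ε^{#X}` and `X` is connected. `HardCoreUrsell` develops
the Ursell-function (Friedli–Velenik Prop. 5.3) side of the same expansion for the hard-sphere
gas; the present file follows [KP86] (no Ursell functions: `Φ^T` is defined by Möbius inversion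
(3) of the branch `log Z`).

## References

* [KP86] R. Kotecký, D. Preiss, *Cluster expansion for abstract polymer models*,
  Comm. Math. Phys. 103 (1986) 491–498: §2 (setting, Theorem with (1)–(4), Proposition with
  (5)), §3 (proof). [KoteckyPreiss1986]
* [FV17] S. Friedli, Y. Velenik, *Statistical Mechanics of Lattice Systems* (CUP 2017), Ch. 5:
  Def. 5.2, Prop. 5.3, Thm. 5.4 (condition (5.10)), Thm. 5.8, §5.6. [FriedliVelenik2017]
* [FLP20] P. M. S. Fialho, B. N. B. de Lima, A. Procacci, *Abstract polymer gas: a simple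
  inductive proof of the Fernández–Procacci criterion*, J. Stat. Phys. 179 (2020),
  arXiv:2001.00652 (inductive proofs à la Dobrushin).
-/

noncomputable section

open Finset Filter Topology
open scoped BigOperators

namespace Literature.Probability.LatticeModels

variable {P : Type*} [DecidableEq P] {inc : P → P → Prop} [DecidableRel inc]

/-! ### Compatible families and the partition function (`PolymerGas` vocabulary) -/

omit [DecidableEq P] [DecidableRel inc] in
/-- Compatibility of a family, unfolded: distinct members are not incompatible. [folklore] -/
theorem isCompatible_iff {X : Finset P} :
    IsCompatible inc X ↔ ∀ γ ∈ X, ∀ γ' ∈ X, γ ≠ γ' → ¬ inc γ γ' := Iff.rfl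

omit [DecidableEq P] [DecidableRel inc] in
/-- The empty family is compatible. [folklore] -/
theorem isCompatible_empty : IsCompatible inc (∅ : Finset P) := by
  simp [IsCompatible]

omit [DecidableEq P] [DecidableRel inc] in
/-- Symmetry of incompatibility in the form taken by the lemmas of `PolymerGas`. [folklore] -/
theorem inc_symm_of_symm [Std.Symm inc] : ∀ γ γ' : P, inc γ γ' → inc γ' γ :=
  fun γ γ' h => Std.Symm.symm γ γ' h

/-- The partition function as a sum over the compatible subfamilies only
(`Finset.sum_filter`). [folklore] -/
theorem polymerPartitionFunction_eq_sum_filter (w : P → ℂ) (Λ : Finset P) :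
    polymerPartitionFunction inc w Λ =
      ∑ X ∈ Λ.powerset with IsCompatible inc X, ∏ γ ∈ X, w γ := by
  unfold polymerPartitionFunction
  rw [Finset.sum_filter]

/-- The partition function only depends on the activities of the polymers in the volume.
[folklore] -/
theorem polymerPartitionFunction_congr {w w' : P → ℂ} {Λ : Finset P} (h : ∀ γ ∈ Λ, w γ = w' γ) :
    polymerPartitionFunction inc w Λ = polymerPartitionFunction inc w' Λ := by
  unfold polymerPartitionFunction
  refine Finset.sum_congr rfl fun X hX => ?_
  rw [Finset.prod_congr rfl fun γ hγ => h γ (Finset.mem_powerset.1 hX hγ)]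

/-- **Deletion of a clique of pairwise incompatible polymers**: a compatible family contains at
most one polymer of a set `D` of pairwise incompatible polymers, so
`Z(Λ) = Z(Λ ∖ D) + ∑_{γ ∈ D} w γ · Z({γ' ∈ Λ ∖ D | inc γ γ'})` (e.g. `D` = the polymers containing
a given site; [KP86, §3]). [cite: KoteckyPreiss1986, §3] -/
theorem polymerPartitionFunction_eq_sdiff_add_sum [Std.Symm inc] (w : P → ℂ) {Λ D : Finset P}
    (hD : D ⊆ Λ) (hclique : ∀ γ ∈ D, ∀ γ' ∈ D, γ ≠ γ' → inc γ γ') :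
    polymerPartitionFunction inc w Λ =
      polymerPartitionFunction inc w (Λ \ D) +
        ∑ γ ∈ D, w γ * polymerPartitionFunction inc w ((Λ \ D).filter fun γ' => ¬ inc γ γ') := by
  induction D using Finset.induction_on with
  | empty => simp
  | insert γ D hγD ih =>
    have hDΛ : D ⊆ Λ := (Finset.subset_insert γ D).trans hD
    have hγΛ : γ ∈ Λ := hD (Finset.mem_insert_self γ D)
    have hcl : ∀ γ₁ ∈ D, ∀ γ₂ ∈ D, γ₁ ≠ γ₂ → inc γ₁ γ₂ := fun γ₁ h₁ γ₂ h₂ =>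
      hclique γ₁ (Finset.mem_insert_of_mem h₁) γ₂ (Finset.mem_insert_of_mem h₂)
    rw [ih hDΛ hcl, Finset.sum_insert hγD]
    have hsplit : Λ \ D = insert γ (Λ \ insert γ D) := by
      ext γ'
      simp only [Finset.mem_sdiff, Finset.mem_insert]
      constructor
      · rintro ⟨h1, h2⟩
        by_cases h : γ' = γ
        · exact Or.inl h
        · exact Or.inr ⟨h1, fun h' => h'.elim h h2⟩
      · rintro (rfl | ⟨h1, h2⟩)
        · exact ⟨hγΛ, hγD⟩
        · exact ⟨h1, fun h => h2 (Or.inr h)⟩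
    have hγ' : γ ∉ Λ \ insert γ D := fun h => (Finset.mem_sdiff.1 h).2 (Finset.mem_insert_self γ D)
    rw [hsplit, polymerPartitionFunction_insert inc_symm_of_symm w hγ']
    have hfilt : ∀ γ₁ ∈ D, (insert γ (Λ \ insert γ D)).filter (fun γ' => ¬ inc γ₁ γ') =
        (Λ \ insert γ D).filter (fun γ' => ¬ inc γ₁ γ') := by
      intro γ₁ h₁
      rw [Finset.filter_insert, if_neg]
      exact not_not_intro (hclique γ₁ (Finset.mem_insert_of_mem h₁) γ (Finset.mem_insert_self γ D)
        (fun h => hγD (h ▸ h₁)))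
    rw [Finset.sum_congr rfl fun γ₁ h₁ => by rw [hfilt γ₁ h₁]]
    ring

/-! ### The Kotecký–Preiss condition in finite volume and zero-freeness -/

section KP

/-- The Kotecký–Preiss size `x_γ = ‖w γ‖ e^{a γ}` of a polymer: the summand of [KP86, (1)] with
`d = 0` (Friedli–Velenik (5.10)). Not to be confused with the Dobrushin weight `μ` of
`PolymerGas` / `PolymerGasGeometric.kpWeight` (`μ X = λ^{#X}`): for `a X = #X` and
`‖w X‖ ≤ ε^{#X}` one has `kpTerm w a X ≤ (e ε)^{#X}`. [cite: KoteckyPreiss1986, (1)] -/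
def kpTerm (w : P → ℂ) (a : P → ℝ) (γ : P) : ℝ := ‖w γ‖ * Real.exp (a γ)

omit [DecidableEq P] in
/-- The KP size of a polymer is non-negative. [folklore] -/
theorem kpTerm_nonneg (w : P → ℂ) (a : P → ℝ) (γ : P) : 0 ≤ kpTerm w a γ :=
  mul_nonneg (norm_nonneg _) (Real.exp_nonneg _)

/-- A finite set of polymers `C` is incompatible with (touches) the polymer `γ`, `C ι γ`: some
member of `C` is incompatible with `γ` ([KP86, §2], "we write `C ι γ` whenever there exists
`γ' ∈ C` such that `γ' ι γ`"). [cite: KoteckyPreiss1986, §2] -/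
def KPTouches (inc : P → P → Prop) (C : Finset P) (γ : P) : Prop := ∃ γ' ∈ C, inc γ' γ

/-- The finite-volume **Kotecký–Preiss condition** on the volume `Λ` with size function `a`:
for every `γ ∈ Λ`, `∑_{γ' ∈ Λ, γ' ι γ} ‖w γ'‖ e^{a γ'} ≤ a γ`, the sum running over the polymers of
`Λ` incompatible with `γ` (for a reflexive `inc` the term `γ' = γ` is present, as in
[KP86, (1)] and in Friedli–Velenik (5.10), where `ζ(γ, γ) = -1`). This is [KP86, (1)] with `d = 0` restricted to a finite volume; (1) with
`d ≥ 0` implies it. [cite: KoteckyPreiss1986, (1)] -/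
def IsKPVolume (inc : P → P → Prop) [DecidableRel inc] (w : P → ℂ) (a : P → ℝ) (Λ : Finset P) :
    Prop :=
  ∀ γ ∈ Λ, ∑ γ' ∈ Λ with inc γ' γ, kpTerm w a γ' ≤ a γ

omit [DecidableEq P] in
/-- The KP condition is inherited by sub-volumes. [folklore] -/
theorem IsKPVolume.mono {w : P → ℂ} {a : P → ℝ} {Λ Λ' : Finset P} (h : IsKPVolume inc w a Λ)
    (hΛ' : Λ' ⊆ Λ) : IsKPVolume inc w a Λ' := fun γ hγ =>
  (Finset.sum_le_sum_of_subset_of_nonneg (Finset.filter_subset_filter _ hΛ')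
    fun γ' _ _ => kpTerm_nonneg w a γ').trans (h γ (hΛ' hγ))

/-- Telescoping one-polymer ratio bounds: if on every sub-volume of `T` removing one polymer
`γ` changes the partition function by a factor of norm at most `e^{x γ}`, then removing a set
`D` costs at most `e^{∑_{γ ∈ D} x γ}`. [folklore] -/
theorem norm_polymerPartitionFunction_sdiff_div_le_of_forall {w : P → ℂ} {x : P → ℝ} {T : Finset P}
    (h : ∀ T' ⊆ T, ∀ γ ∈ T', polymerPartitionFunction inc w T' ≠ 0 ∧
      ‖polymerPartitionFunction inc w (T'.erase γ) / polymerPartitionFunction inc w T'‖ ≤ Real.exp (x γ))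
    {D : Finset P} (hD : D ⊆ T) :
    ‖polymerPartitionFunction inc w (T \ D) / polymerPartitionFunction inc w T‖ ≤ Real.exp (∑ γ ∈ D, x γ) := by
  have hZ : ∀ T' ⊆ T, polymerPartitionFunction inc w T' ≠ 0 := fun T' hT' => by
    rcases T'.eq_empty_or_nonempty with rfl | ⟨γ, hγ⟩
    · rw [polymerPartitionFunction_empty]; exact one_ne_zero
    · exact (h T' hT' γ hγ).1
  induction D using Finset.induction_on with
  | empty => simp [div_self (hZ T Finset.Subset.rfl)]
  | insert γ D hγD ih =>
    have hγT : γ ∈ T := hD (Finset.mem_insert_self γ D)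
    have hDT : D ⊆ T := (Finset.subset_insert γ D).trans hD
    have hγTD : γ ∈ T \ D := Finset.mem_sdiff.2 ⟨hγT, hγD⟩
    rw [Finset.sdiff_insert, Finset.sum_insert hγD, Real.exp_add]
    have hsplit : polymerPartitionFunction inc w ((T \ D).erase γ) / polymerPartitionFunction inc w T =
        polymerPartitionFunction inc w ((T \ D).erase γ) / polymerPartitionFunction inc w (T \ D) *
          (polymerPartitionFunction inc w (T \ D) / polymerPartitionFunction inc w T) := by
      rw [div_mul_div_cancel₀ (hZ _ Finset.sdiff_subset)]
    rw [hsplit, norm_mul]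
    exact mul_le_mul ((h _ Finset.sdiff_subset γ hγTD).2) (ih hDT) (norm_nonneg _)
      (Real.exp_nonneg _)

/-- The elementary inequality behind the Kotecký–Preiss induction: `e^{-x} ≤ 1 - x e^{-x}`,
i.e. `1 + x ≤ e^{x}`. [folklore] -/
theorem exp_neg_le_one_sub_mul_exp_neg (x : ℝ) : Real.exp (-x) ≤ 1 - x * Real.exp (-x) := by
  have h := mul_le_mul_of_nonneg_right (Real.add_one_le_exp x) (Real.exp_nonneg (-x))
  rw [← Real.exp_add, add_neg_cancel, Real.exp_zero, add_mul, one_mul] at h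
  linarith

/-- **Zero-freeness and one-polymer ratio bounds under the Kotecký–Preiss condition**
([KP86, Theorem, first assertion]: `𝒵(L; Φ) ≠ 0`; the quantitative ratio bounds are the
Dobrushin-type inductive form, cf. [FLP20]). If `Λ` satisfies the finite-volume KP condition
`IsKPVolume inc w a Λ`, then for every `Λ' ⊆ Λ` the partition function `Z(Λ'; w)` is non-zero and
for every `γ ∈ Λ'`, with `x_γ = ‖w γ‖ e^{a γ}`:
`e^{-x_γ} ≤ ‖Z(Λ' ∖ γ)/Z(Λ')‖ ≤ e^{x_γ}` and `‖Z(Λ')/Z(Λ' ∖ γ) - 1‖ ≤ x_γ e^{-x_γ}`.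
Proof: strong induction on `Λ'`; by the deletion recursion `Z(Λ') = Z(Λ' ∖ γ)(1 + u)` with
`u = w γ · Z(F)/Z(Λ' ∖ γ)`, `F` the polymers of `Λ' ∖ γ` compatible with `γ`; telescoping the
induction hypothesis over `(Λ' ∖ γ) ∖ F` (polymers incompatible with `γ`) and the KP condition
at `γ` give `‖u‖ ≤ ‖w γ‖ e^{a γ - x_γ} = x_γ e^{-x_γ} < 1`, and `1/(1 - x e^{-x}) ≤ e^{x}`. [cite: KoteckyPreiss1986, Theorem p. 492 (zero-freeness)] -/
theorem polymerPartitionFunction_kp_bounds [Std.Refl inc] [Std.Symm inc] {w : P → ℂ} {a : P → ℝ} {Λ : Finset P}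
    (hKP : IsKPVolume inc w a Λ) :
    ∀ Λ' ⊆ Λ, polymerPartitionFunction inc w Λ' ≠ 0 ∧ ∀ γ ∈ Λ',
      ‖polymerPartitionFunction inc w (Λ'.erase γ) / polymerPartitionFunction inc w Λ'‖ ≤ Real.exp (kpTerm w a γ) ∧
      Real.exp (-kpTerm w a γ) ≤ ‖polymerPartitionFunction inc w (Λ'.erase γ) / polymerPartitionFunction inc w Λ'‖ ∧
      ‖polymerPartitionFunction inc w Λ' / polymerPartitionFunction inc w (Λ'.erase γ) - 1‖ ≤
        kpTerm w a γ * Real.exp (-kpTerm w a γ) := by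
  intro Λ'
  induction Λ' using Finset.strongInductionOn with
  | _ Λ' ih => ?_
  intro hΛ'Λ
  -- Step 1: for every `γ ∈ Λ'`, `Z(Λ') = Z(Λ' ∖ γ)(1 + u)` with `‖u‖ ≤ x_γ e^{-x_γ}`.
  have key : ∀ γ ∈ Λ', polymerPartitionFunction inc w (Λ'.erase γ) ≠ 0 ∧ ∃ u : ℂ,
      polymerPartitionFunction inc w Λ' = polymerPartitionFunction inc w (Λ'.erase γ) * (1 + u) ∧
        ‖u‖ ≤ kpTerm w a γ * Real.exp (-kpTerm w a γ) := by
    intro γ hγ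
    have hΛ₁ : Λ'.erase γ ⊂ Λ' := Finset.erase_ssubset hγ
    have hZ₁ : polymerPartitionFunction inc w (Λ'.erase γ) ≠ 0 := (ih _ hΛ₁ ((Finset.erase_subset γ Λ').trans hΛ'Λ)).1
    have hT : ∀ T' ⊆ Λ'.erase γ, ∀ γ' ∈ T', polymerPartitionFunction inc w T' ≠ 0 ∧
        ‖polymerPartitionFunction inc w (T'.erase γ') / polymerPartitionFunction inc w T'‖ ≤ Real.exp (kpTerm w a γ') := by
      intro T' hT' γ' hγ'
      have hT'Λ' : T' ⊂ Λ' := Finset.ssubset_of_subset_of_ssubset hT' hΛ₁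
      have r := ih T' hT'Λ' (hT'Λ'.1.trans hΛ'Λ)
      exact ⟨r.1, (r.2 γ' hγ').1⟩
    have htel := norm_polymerPartitionFunction_sdiff_div_le_of_forall hT
      (D := Λ'.erase γ \ (Λ'.erase γ).filter fun γ' => ¬ inc γ γ') Finset.sdiff_subset
    rw [Finset.sdiff_sdiff_eq_self (Finset.filter_subset _ _)] at htel
    -- the exponent is at most `a γ - x_γ` by the KP condition at `γ`
    have hsum : ∑ γ' ∈ Λ'.erase γ \ (Λ'.erase γ).filter (fun γ' => ¬ inc γ γ'), kpTerm w a γ' ≤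
        a γ - kpTerm w a γ := by
      have hKPγ := hKP γ (hΛ'Λ hγ)
      have hγS : γ ∈ Λ.filter (fun γ' => inc γ' γ) :=
        Finset.mem_filter.2 ⟨hΛ'Λ hγ, Std.Refl.refl γ⟩
      rw [← Finset.add_sum_erase _ _ hγS] at hKPγ
      have hDS : Λ'.erase γ \ (Λ'.erase γ).filter (fun γ' => ¬ inc γ γ') ⊆
          (Λ.filter (fun γ' => inc γ' γ)).erase γ := by
        intro γ' hγ'
        rw [Finset.mem_sdiff] at hγ'
        obtain ⟨h1, h2⟩ := hγ'
        have hR : inc γ' γ := by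
          by_contra hn
          exact h2 (Finset.mem_filter.2 ⟨h1, fun h' => hn (Std.Symm.symm _ _ h')⟩)
        exact Finset.mem_erase.2 ⟨Finset.ne_of_mem_erase h1, Finset.mem_filter.2
          ⟨hΛ'Λ (Finset.mem_of_mem_erase h1), hR⟩⟩
      have := Finset.sum_le_sum_of_subset_of_nonneg hDS fun γ' _ _ => kpTerm_nonneg w a γ'
      linarith
    refine ⟨hZ₁, w γ * (polymerPartitionFunction inc w ((Λ'.erase γ).filter fun γ' => ¬ inc γ γ') /
      polymerPartitionFunction inc w (Λ'.erase γ)), ?_, ?_⟩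
    · rw [polymerPartitionFunction_eq_erase_add inc_symm_of_symm w hγ]
      field_simp
    · rw [norm_mul]
      calc ‖w γ‖ * ‖polymerPartitionFunction inc w ((Λ'.erase γ).filter fun γ' => ¬ inc γ γ') /
            polymerPartitionFunction inc w (Λ'.erase γ)‖
          ≤ ‖w γ‖ * Real.exp (a γ - kpTerm w a γ) :=
            mul_le_mul_of_nonneg_left (htel.trans (Real.exp_le_exp.2 hsum)) (norm_nonneg _)
        _ = kpTerm w a γ * Real.exp (-kpTerm w a γ) := by
            rw [Real.exp_sub, kpTerm, Real.exp_neg]; ring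
  -- Step 2: conclusions.
  have hx1 : ∀ γ, kpTerm w a γ * Real.exp (-kpTerm w a γ) < 1 := fun γ => by
    rw [Real.exp_neg, ← div_eq_mul_inv, div_lt_one (Real.exp_pos _)]
    exact lt_of_lt_of_le (lt_add_one _) (Real.add_one_le_exp _)
  refine ⟨?_, fun γ hγ => ?_⟩
  · rcases Λ'.eq_empty_or_nonempty with rfl | ⟨γ, hγ⟩
    · rw [polymerPartitionFunction_empty]; exact one_ne_zero
    · obtain ⟨hZ₁, u, hu, hub⟩ := key γ hγ
      rw [hu]
      refine mul_ne_zero hZ₁ fun h1u => ?_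
      rw [eq_neg_of_add_eq_zero_right h1u, norm_neg, norm_one] at hub
      linarith [hx1 γ]
  · obtain ⟨hZ₁, u, hu, hub⟩ := key γ hγ
    set x := kpTerm w a γ with hx
    have hx0 : 0 ≤ x := kpTerm_nonneg w a γ
    have hlow : Real.exp (-x) ≤ ‖1 + u‖ := by
      calc Real.exp (-x) ≤ 1 - x * Real.exp (-x) := exp_neg_le_one_sub_mul_exp_neg x
        _ ≤ 1 - ‖u‖ := by linarith
        _ ≤ ‖1 + u‖ := by
          have := norm_sub_norm_le (1 : ℂ) (-u)
          rw [norm_one, norm_neg, sub_neg_eq_add] at this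
          linarith
    have hup : ‖1 + u‖ ≤ Real.exp x := by
      calc ‖1 + u‖ ≤ ‖(1 : ℂ)‖ + ‖u‖ := norm_add_le _ _
        _ ≤ 1 + x := by
          rw [norm_one]
          have : x * Real.exp (-x) ≤ x := by
            have : Real.exp (-x) ≤ 1 := Real.exp_le_one_iff.2 (by linarith)
            nlinarith
          linarith
        _ ≤ Real.exp x := by linarith [Real.add_one_le_exp x]
    have h1u : 1 + u ≠ 0 := fun h => by
      rw [h, norm_zero] at hlow; linarith [Real.exp_pos (-x)]
    have hratio : polymerPartitionFunction inc w (Λ'.erase γ) / polymerPartitionFunction inc w Λ' = (1 + u)⁻¹ := by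
      rw [hu, div_mul_eq_div_div, div_self hZ₁, one_div]
    have hratio' : polymerPartitionFunction inc w Λ' / polymerPartitionFunction inc w (Λ'.erase γ) = 1 + u := by
      rw [hu, mul_div_cancel_left₀ _ hZ₁]
    refine ⟨?_, ?_, ?_⟩
    · rw [hratio, norm_inv]
      calc ‖1 + u‖⁻¹ ≤ (Real.exp (-x))⁻¹ := inv_anti₀ (Real.exp_pos _) hlow
        _ = Real.exp x := by rw [Real.exp_neg, inv_inv]
    · rw [hratio, norm_inv]
      calc Real.exp (-x) = (Real.exp x)⁻¹ := Real.exp_neg x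
        _ ≤ ‖1 + u‖⁻¹ := inv_anti₀ (lt_of_lt_of_le (Real.exp_pos _) hlow) hup
    · rw [hratio', add_sub_cancel_left]
      exact hub

/-- Telescoping one-polymer lower ratio bounds (cf. `norm_polymerPartitionFunction_sdiff_div_le_of_forall`).
[folklore] -/
theorem LEnorm_polymerPartitionFunction_sdiff_div_le_of_forall {w : P → ℂ} {x : P → ℝ} {T : Finset P}
    (h : ∀ T' ⊆ T, ∀ γ ∈ T', polymerPartitionFunction inc w T' ≠ 0 ∧
      Real.exp (-x γ) ≤ ‖polymerPartitionFunction inc w (T'.erase γ) / polymerPartitionFunction inc w T'‖)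
    {D : Finset P} (hD : D ⊆ T) :
    Real.exp (-∑ γ ∈ D, x γ) ≤ ‖polymerPartitionFunction inc w (T \ D) / polymerPartitionFunction inc w T‖ := by
  have hZ : ∀ T' ⊆ T, polymerPartitionFunction inc w T' ≠ 0 := fun T' hT' => by
    rcases T'.eq_empty_or_nonempty with rfl | ⟨γ, hγ⟩
    · rw [polymerPartitionFunction_empty]; exact one_ne_zero
    · exact (h T' hT' γ hγ).1
  induction D using Finset.induction_on with
  | empty => simp [div_self (hZ T Finset.Subset.rfl)]
  | insert γ D hγD ih =>
    have hγT : γ ∈ T := hD (Finset.mem_insert_self γ D)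
    have hDT : D ⊆ T := (Finset.subset_insert γ D).trans hD
    have hγTD : γ ∈ T \ D := Finset.mem_sdiff.2 ⟨hγT, hγD⟩
    rw [Finset.sdiff_insert, Finset.sum_insert hγD, neg_add, Real.exp_add]
    have hsplit : polymerPartitionFunction inc w ((T \ D).erase γ) / polymerPartitionFunction inc w T =
        polymerPartitionFunction inc w ((T \ D).erase γ) / polymerPartitionFunction inc w (T \ D) *
          (polymerPartitionFunction inc w (T \ D) / polymerPartitionFunction inc w T) := by
      rw [div_mul_div_cancel₀ (hZ _ Finset.sdiff_subset)]
    rw [hsplit, norm_mul]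
    exact mul_le_mul ((h _ Finset.sdiff_subset γ hγTD).2) (ih hDT) (Real.exp_nonneg _)
      (norm_nonneg _)

/-- **Zero-freeness under the Kotecký–Preiss condition** ([KP86, Theorem, first assertion]):
`Z(Λ'; w) ≠ 0` for every sub-volume `Λ'` of a KP volume. [cite: KoteckyPreiss1986, Theorem p. 492 (zero-freeness)] -/
theorem polymerPartitionFunction_ne_zero_of_kp [Std.Refl inc] [Std.Symm inc] {w : P → ℂ} {a : P → ℝ} {Λ Λ' : Finset P}
    (hKP : IsKPVolume inc w a Λ) (hΛ' : Λ' ⊆ Λ) : polymerPartitionFunction inc w Λ' ≠ 0 :=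
  (polymerPartitionFunction_kp_bounds hKP Λ' hΛ').1

/-- Removing a set `D` of polymers from a KP volume changes the partition function by a
factor of norm at most `exp (∑_{γ ∈ D} ‖w γ‖ e^{a γ})` (telescoped [KP86]-type ratio bound;
cf. Friedli–Velenik (5.29)). [folklore] -/
theorem norm_polymerPartitionFunction_sdiff_div_le_of_kp [Std.Refl inc] [Std.Symm inc] {w : P → ℂ} {a : P → ℝ} {Λ Λ' D : Finset P}
    (hKP : IsKPVolume inc w a Λ) (hΛ' : Λ' ⊆ Λ) (hD : D ⊆ Λ') :
    ‖polymerPartitionFunction inc w (Λ' \ D) / polymerPartitionFunction inc w Λ'‖ ≤ Real.exp (∑ γ ∈ D, kpTerm w a γ) :=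
  norm_polymerPartitionFunction_sdiff_div_le_of_forall (fun T' hT' γ hγ =>
    have r := polymerPartitionFunction_kp_bounds hKP T' (hT'.trans hΛ')
    ⟨r.1, (r.2 γ hγ).1⟩) hD

/-- Removing a set `D` of polymers from a KP volume changes the partition function by a
factor of norm at least `exp (-∑_{γ ∈ D} ‖w γ‖ e^{a γ})`. [folklore] -/
theorem le_norm_polymerPartitionFunction_sdiff_div_of_kp [Std.Refl inc] [Std.Symm inc] {w : P → ℂ} {a : P → ℝ} {Λ Λ' D : Finset P}
    (hKP : IsKPVolume inc w a Λ) (hΛ' : Λ' ⊆ Λ) (hD : D ⊆ Λ') :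
    Real.exp (-∑ γ ∈ D, kpTerm w a γ) ≤ ‖polymerPartitionFunction inc w (Λ' \ D) / polymerPartitionFunction inc w Λ'‖ :=
  LEnorm_polymerPartitionFunction_sdiff_div_le_of_forall (fun T' hT' γ hγ =>
    have r := polymerPartitionFunction_kp_bounds hKP T' (hT'.trans hΛ')
    ⟨r.1, (r.2 γ hγ).2.1⟩) hD

omit [DecidableEq P] in
/-- The KP condition bounds the total size of the polymers incompatible with a set `Δ`:
if every polymer of `D ⊆ Λ` is incompatible with some polymer of `Δ ⊆ Λ`, then
`∑_{γ ∈ D} ‖w γ‖ e^{a γ} ≤ ∑_{γ ∈ Δ} a γ`. [folklore] -/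
theorem sum_kpTerm_le_sum_of_incompatible {w : P → ℂ} {a : P → ℝ} {Λ D Δ : Finset P}
    (hKP : IsKPVolume inc w a Λ) (hD : D ⊆ Λ) (hΔ : Δ ⊆ Λ)
    (hinc : ∀ γ' ∈ D, ∃ γ ∈ Δ, inc γ' γ) :
    ∑ γ' ∈ D, kpTerm w a γ' ≤ ∑ γ ∈ Δ, a γ := by
  calc ∑ γ' ∈ D, kpTerm w a γ'
      ≤ ∑ γ' ∈ D, ∑ γ ∈ Δ with (inc γ' γ), kpTerm w a γ' := by
        refine Finset.sum_le_sum fun γ' hγ' => ?_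
        rw [Finset.sum_const, nsmul_eq_mul]
        have hpos : (1 : ℝ) ≤ (Δ.filter fun γ => inc γ' γ).card := by
          obtain ⟨γ, hγ, hγγ⟩ := hinc γ' hγ'
          exact_mod_cast Finset.card_pos.2 ⟨γ, Finset.mem_filter.2 ⟨hγ, hγγ⟩⟩
        nlinarith [kpTerm_nonneg w a γ']
    _ = ∑ γ ∈ Δ, ∑ γ' ∈ D with (inc γ' γ), kpTerm w a γ' := by
        rw [Finset.sum_comm' (t' := Δ) (s' := fun γ => D.filter fun γ' => inc γ' γ)]
        intro γ' γ
        simp only [Finset.mem_filter]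
        tauto
    _ ≤ ∑ γ ∈ Δ, a γ := Finset.sum_le_sum fun γ hγ =>
        (Finset.sum_le_sum_of_subset_of_nonneg (Finset.filter_subset_filter _ hD)
          fun γ' _ _ => kpTerm_nonneg w a γ').trans (hKP γ (hΔ hγ))

end KP

/-! ### Clusters, the Kotecký–Preiss logarithm and the truncated functional -/

section ClusterExpansion


/-- A finite set of polymers is a **cluster** if it is not decomposable into two non-empty
parts `C = C₁ ∪ C₂` such that no pair `γ₁ ∈ C₁`, `γ₂ ∈ C₂` is incompatible ([KP86, §2];
Friedli–Velenik §5.6 "non-decomposable"). As in [KP86] the empty set and singletons are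
clusters. [cite: KoteckyPreiss1986, §2] -/
def IsPolymerCluster (inc : P → P → Prop) (C : Finset P) : Prop :=
  ∀ C₁ ⊆ C, C₁.Nonempty → (C \ C₁).Nonempty → ∃ γ₁ ∈ C₁, ∃ γ₂ ∈ C \ C₁, inc γ₁ γ₂

variable (inc)

/-- The derivative `d/dt Z(Λ; t • w) = ∑_{X ⊆ Λ compatible} |X| t^{|X| - 1} ∏_{γ ∈ X} w γ` of the
partition function along the ray through the activity `w`. [folklore] -/
def polymerRayDeriv (w : P → ℂ) (Λ : Finset P) (t : ℝ) : ℂ :=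
  ∑ X ∈ Λ.powerset with IsCompatible inc X, (X.card : ℂ) * (t : ℂ) ^ (X.card - 1) * ∏ γ ∈ X, w γ

/-- The **Kotecký–Preiss logarithm** `log Z(Λ; w)`: [KP86, §2] define `log 𝒵(L; Φ)`, on a
contractible set of functionals on which `𝒵(L; ·)` does not vanish, as the continuous branch
with `log 𝒵(L; 0) = 0`; along the segment `t ↦ t • w`, `t ∈ [0, 1]` (which stays in the set of
functionals obeying (1)), this branch is `∫₀¹ (d/dt) Z(Λ; t w) / Z(Λ; t w) dt`, which we take as
the definition. It is meaningful when `Z(Λ; t w) ≠ 0` for `t ∈ [0, 1]` (e.g. under the KP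
condition, `polymerPartitionFunction_ne_zero_of_kp`); otherwise it is a junk value. [cite: KoteckyPreiss1986, §2 (definition of log 𝒵(L; Φ))] -/
def polymerLogZ (w : P → ℂ) (Λ : Finset P) : ℂ :=
  ∫ t in (0 : ℝ)..1, polymerRayDeriv inc w Λ t / polymerPartitionFunction inc (fun γ => (t : ℂ) * w γ) Λ

/-- The **truncated functional** `Φ^T(C) = ∑_{B ⊆ C} (-1)^{|C ∖ B|} log Z(B; w)`, the Möbius
transform of the Kotecký–Preiss logarithm ([KP86, (3)]). [cite: KoteckyPreiss1986, (3)] -/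
def truncatedWeight (w : P → ℂ) (C : Finset P) : ℂ :=
  ∑ B ∈ C.powerset, (-1 : ℂ) ^ (C \ B).card * polymerLogZ inc w B

variable {inc}

/-- **Möbius inversion on the Boolean lattice**: for any set function `f`,
`∑_{C ⊆ L} ∑_{B ⊆ C} (-1)^{|C ∖ B|} f(B) = f(L)`. [folklore] -/
theorem sum_powerset_sum_powerset_neg_one_pow_card_sdiff_mul {M : Type*} [CommRing M]
    (f : Finset P → M) (L : Finset P) :
    ∑ C ∈ L.powerset, ∑ B ∈ C.powerset, (-1 : M) ^ (C \ B).card * f B = f L := by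
  rw [Finset.sum_comm' (t' := L.powerset) (s' := fun B => Finset.Icc B L) (by
    intro C B
    simp only [Finset.mem_powerset, Finset.mem_Icc]
    exact ⟨fun h => ⟨⟨h.2, h.1⟩, h.2.trans h.1⟩, fun h => ⟨h.1.2, h.1.1⟩⟩)]
  have inner : ∀ B ∈ L.powerset,
      ∑ C ∈ Finset.Icc B L, (-1 : M) ^ (C \ B).card * f B = if B = L then f L else 0 := by
    intro B hB
    have hBL : B ⊆ L := Finset.mem_powerset.1 hB
    rw [Finset.Icc_eq_image_powerset hBL, Finset.sum_image]
    · have hT : ∀ T ∈ (L \ B).powerset, (-1 : M) ^ ((B ∪ T) \ B).card * f B =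
          ((-1 : ℤ) ^ T.card : ℤ) * f B := by
        intro T hT
        have hdisj : Disjoint B T :=
          Finset.disjoint_of_subset_right (Finset.mem_powerset.1 hT) Finset.disjoint_sdiff
        rw [Finset.union_sdiff_cancel_left hdisj]
        push_cast
        rfl
      rw [Finset.sum_congr rfl hT, ← Finset.sum_mul, ← Int.cast_sum,
        Finset.sum_powerset_neg_one_pow_card]
      by_cases hBL' : B = L
      · subst hBL'
        simp
      · have hne : L \ B ≠ ∅ := fun h =>
          hBL' (Finset.Subset.antisymm hBL (Finset.sdiff_eq_empty_iff_subset.1 h))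
        simp [hne, hBL']
    · intro T₁ hT₁ T₂ hT₂ hT
      have h₁ : Disjoint B T₁ :=
        Finset.disjoint_of_subset_right (Finset.mem_powerset.1 hT₁) Finset.disjoint_sdiff
      have h₂ : Disjoint B T₂ :=
        Finset.disjoint_of_subset_right (Finset.mem_powerset.1 hT₂) Finset.disjoint_sdiff
      rw [← Finset.union_sdiff_cancel_left h₁, ← Finset.union_sdiff_cancel_left h₂]
      exact congrArg (· \ B) hT
  rw [Finset.sum_congr rfl inner, Finset.sum_ite_eq' L.powerset L (fun _ => f L), if_pos
    (Finset.mem_powerset.2 Finset.Subset.rfl)]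

/-- [KP86, (2)]: `log Z(L; w) = ∑_{C ⊆ L} Φ^T(C)`, by Möbius inversion of (3). [cite: KoteckyPreiss1986, (2)] -/
theorem polymerLogZ_eq_sum_truncatedWeight (w : P → ℂ) (L : Finset P) :
    polymerLogZ inc w L = ∑ C ∈ L.powerset, truncatedWeight inc w C :=
  (sum_powerset_sum_powerset_neg_one_pow_card_sdiff_mul (polymerLogZ inc w) L).symm

/-- `Φ^T(C)` only depends on the activities of the polymers of `C`. [folklore] -/
theorem truncatedWeight_congr {w w' : P → ℂ} {C : Finset P} (h : ∀ γ ∈ C, w γ = w' γ) :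
    truncatedWeight inc w C = truncatedWeight inc w' C := by
  unfold truncatedWeight
  refine Finset.sum_congr rfl fun B hB => ?_
  have hB' : ∀ γ ∈ B, w γ = w' γ := fun γ hγ => h γ (Finset.mem_powerset.1 hB hγ)
  congr 1
  unfold polymerLogZ
  refine intervalIntegral.integral_congr fun t _ => ?_
  rw [polymerPartitionFunction_congr (inc := inc) (w := fun γ => (t : ℂ) * w γ)
    (w' := fun γ => (t : ℂ) * w' γ) (fun γ hγ => by rw [hB' γ hγ])]
  congr 1
  unfold polymerRayDeriv
  refine Finset.sum_congr rfl fun X hX => ?_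
  rw [Finset.prod_congr rfl fun γ hγ => hB' γ
    (Finset.mem_powerset.1 (Finset.mem_filter.1 hX).1 hγ)]

/-- The partition function along a ray: `Z(Λ; c • w) = ∑_{X ⊆ Λ compatible} c^{|X|} ∏_{γ ∈ X} w γ`.
[folklore] -/
theorem polymerPartitionFunction_smul_eq (c : ℂ) (w : P → ℂ) (Λ : Finset P) :
    polymerPartitionFunction inc (fun γ => c * w γ) Λ =
      ∑ X ∈ Λ.powerset with IsCompatible inc X, c ^ X.card * ∏ γ ∈ X, w γ := by
  rw [polymerPartitionFunction_eq_sum_filter]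
  refine Finset.sum_congr rfl fun X _ => ?_
  rw [Finset.prod_mul_distrib, Finset.prod_const]

/-- At zero activity the partition function is `1`. [folklore] -/
theorem polymerPartitionFunction_zero_mul (w : P → ℂ) (Λ : Finset P) :
    polymerPartitionFunction inc (fun γ => (0 : ℂ) * w γ) Λ = 1 := by
  rw [polymerPartitionFunction_smul_eq, Finset.sum_filter]
  rw [Finset.sum_eq_single_of_mem ∅ (Finset.empty_mem_powerset Λ)]
  · simp [isCompatible_empty]
  · intro X _ hX
    rw [zero_pow (Finset.card_ne_zero.2 (Finset.nonempty_iff_ne_empty.2 hX)), zero_mul, ite_self]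

/-- `polymerRayDeriv` is the derivative of `t ↦ Z(Λ; t • w)`. [folklore] -/
theorem hasDerivAt_polymerPartitionFunction_ray (w : P → ℂ) (Λ : Finset P) (t : ℝ) :
    HasDerivAt (fun s : ℝ => polymerPartitionFunction inc (fun γ => (s : ℂ) * w γ) Λ)
      (polymerRayDeriv inc w Λ t) t := by
  have hfun : (fun s : ℝ => polymerPartitionFunction inc (fun γ => (s : ℂ) * w γ) Λ) = fun s : ℝ =>
      ∑ X ∈ Λ.powerset with IsCompatible inc X, (fun z : ℂ => z ^ X.card * ∏ γ ∈ X, w γ) s := by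
    funext s; rw [polymerPartitionFunction_smul_eq]
  rw [hfun]
  unfold polymerRayDeriv
  refine HasDerivAt.fun_sum fun X _ => ?_
  have h := ((hasDerivAt_pow X.card (t : ℂ)).mul_const (∏ γ ∈ X, w γ)).comp_ofReal
  simpa using h

/-- **The Kotecký–Preiss logarithm is a logarithm**: if `Z(Λ; t • w) ≠ 0` for all `t ∈ [0, 1]`
then `exp (log Z(Λ; w)) = Z(Λ; w)` (the function `s ↦ exp(-∫₀ˢ Z'/Z) · Z(s)` has zero
derivative on `[0, 1]` and equals `1` at `s = 0`). [folklore] -/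
theorem exp_polymerLogZ {w : P → ℂ} {Λ : Finset P}
    (hZ : ∀ t ∈ Set.Icc (0 : ℝ) 1, polymerPartitionFunction inc (fun γ => (t : ℂ) * w γ) Λ ≠ 0) :
    Complex.exp (polymerLogZ inc w Λ) = polymerPartitionFunction inc w Λ := by
  -- notation
  set Z : ℝ → ℂ := fun s => polymerPartitionFunction inc (fun γ => (s : ℂ) * w γ) Λ with hZdef
  set Z' : ℝ → ℂ := polymerRayDeriv inc w Λ with hZ'def
  set q : ℝ → ℂ := fun s => Z' s / Z s with hq
  set G : ℝ → ℂ := fun s => ∫ t in (0 : ℝ)..s, q t with hG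
  have hZd : ∀ s, HasDerivAt Z (Z' s) s := hasDerivAt_polymerPartitionFunction_ray w Λ
  have hZc : Continuous Z := continuous_iff_continuousAt.2 fun s => (hZd s).continuousAt
  have hZ'c : Continuous Z' := by
    rw [hZ'def]; unfold polymerRayDeriv; fun_prop
  -- the open set where `Z ≠ 0` contains `[0, 1]`
  set U : Set ℝ := {s | Z s ≠ 0} with hU
  have hUo : IsOpen U := isOpen_ne_fun hZc continuous_const
  have hIU : Set.Icc (0 : ℝ) 1 ⊆ U := fun s hs => hZ s hs
  have hqU : ContinuousOn q U := (hZ'c.continuousOn).div hZc.continuousOn fun s hs => hs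
  -- derivative of `G` on `[0, 1]`
  have hGd : ∀ s ∈ Set.Icc (0 : ℝ) 1, HasDerivAt G (q s) s := by
    intro s hs
    have hint : IntervalIntegrable q MeasureTheory.volume 0 s :=
      (hqU.mono ((Set.uIcc_of_le hs.1).symm ▸ Set.Icc_subset_Icc_right hs.2 |>.trans hIU)).intervalIntegrable
    exact intervalIntegral.integral_hasDerivAt_right hint
      (hqU.stronglyMeasurableAtFilter hUo s (hIU hs)) (hqU.continuousAt (hUo.mem_nhds (hIU hs)))
  -- `H s = exp (-G s) * Z s` is constant on `[0, 1]`
  set H : ℝ → ℂ := fun s => Complex.exp (-G s) * Z s with hH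
  have hHd : ∀ s ∈ Set.Icc (0 : ℝ) 1, HasDerivAt H 0 s := by
    intro s hs
    have h1 : HasDerivAt (fun s => Complex.exp (-G s)) (Complex.exp (-G s) * -q s) s :=
      (hGd s hs).neg.cexp
    have h2 : HasDerivAt (fun s => Complex.exp (-G s) * Z s)
        (Complex.exp (-G s) * -q s * Z s + Complex.exp (-G s) * Z' s) s := h1.mul (hZd s)
    have hZs : Z s ≠ 0 := hZ s hs
    refine h2.congr_deriv ?_
    show Complex.exp (-G s) * -(Z' s / Z s) * Z s + Complex.exp (-G s) * Z' s = 0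
    field_simp
    ring
  have hconst := constant_of_has_deriv_right_zero (f := H) (a := 0) (b := 1)
    (fun s hs => (hHd s hs).continuousAt.continuousWithinAt)
    (fun s hs => (hHd s (Set.Ico_subset_Icc_self hs)).hasDerivWithinAt)
  have h01 := hconst 1 ⟨zero_le_one, le_rfl⟩
  -- evaluate at the endpoints
  have hG0 : G 0 = 0 := by simp [hG]
  have hZ0 : Z 0 = 1 := by
    simp only [hZdef, Complex.ofReal_zero]
    exact polymerPartitionFunction_zero_mul w Λ
  have hZ1 : Z 1 = polymerPartitionFunction inc w Λ := by
    simp only [hZdef, Complex.ofReal_one, one_mul]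
  have hG1 : G 1 = polymerLogZ inc w Λ := rfl
  simp only [hH, hG0, neg_zero, Complex.exp_zero, one_mul, hZ0, hZ1, hG1] at h01
  -- `exp(-log Z) * Z = 1`
  have hexp : Complex.exp (-polymerLogZ inc w Λ) ≠ 0 := Complex.exp_ne_zero _
  calc Complex.exp (polymerLogZ inc w Λ)
      = Complex.exp (polymerLogZ inc w Λ) * (Complex.exp (-polymerLogZ inc w Λ) * polymerPartitionFunction inc w Λ) := by
        rw [h01, mul_one]
    _ = polymerPartitionFunction inc w Λ := by
        rw [← mul_assoc, ← Complex.exp_add, add_neg_cancel, Complex.exp_zero, one_mul]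

/-- Under the Kotecký–Preiss condition the KP logarithm is a logarithm of the partition
function: `exp (log Z(Λ'; w)) = Z(Λ'; w)` for every sub-volume `Λ'` of a KP volume (the whole
segment `t • w`, `t ∈ [0,1]`, consists of KP activities). [cite: KoteckyPreiss1986, §2 and Theorem p. 492] -/
theorem exp_polymerLogZ_of_kp [Std.Refl inc] [Std.Symm inc] {w : P → ℂ} {a : P → ℝ} {Λ Λ' : Finset P}
    (hKP : IsKPVolume inc w a Λ) (hΛ' : Λ' ⊆ Λ) :
    Complex.exp (polymerLogZ inc w Λ') = polymerPartitionFunction inc w Λ' := by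
  refine exp_polymerLogZ fun t ht => ?_
  have hKPt : IsKPVolume inc (fun γ => (t : ℂ) * w γ) a Λ := fun γ hγ => by
    refine le_trans (Finset.sum_le_sum fun γ' _ => ?_) (hKP γ hγ)
    unfold kpTerm
    refine mul_le_mul_of_nonneg_right ?_ (Real.exp_nonneg _)
    rw [norm_mul, Complex.norm_real, Real.norm_eq_abs, abs_of_nonneg ht.1]
    exact mul_le_of_le_one_left (norm_nonneg _) ht.2
  exact polymerPartitionFunction_ne_zero_of_kp hKPt hΛ'

/-- **Factorisation over mutually compatible parts**: if `A` and `B` are disjoint and every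
polymer of `A` is compatible with every polymer of `B`, then `Z(A ∪ B) = Z(A) Z(B)`
([KP86, §2]; Friedli–Velenik §5.6). [folklore] -/
theorem polymerPartitionFunction_union_of_forall_not [Std.Symm inc] (w : P → ℂ)
    {A B : Finset P} (hdisj : Disjoint A B) (hAB : ∀ γ₁ ∈ A, ∀ γ₂ ∈ B, ¬ inc γ₁ γ₂) :
    polymerPartitionFunction inc w (A ∪ B) = polymerPartitionFunction inc w A * polymerPartitionFunction inc w B := by
  induction B using Finset.strongInductionOn with
  | _ B ih => ?_
  rcases B.eq_empty_or_nonempty with rfl | ⟨γ, hγ⟩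
  · simp
  · have hγA : γ ∉ A := fun h => Finset.disjoint_left.1 hdisj h hγ
    have hBγ : B = insert γ (B.erase γ) := (Finset.insert_erase hγ).symm
    have hγAB : γ ∉ A ∪ B.erase γ := by
      simp [hγA]
    have hunion : A ∪ B = insert γ (A ∪ B.erase γ) := by
      rw [← Finset.union_insert, Finset.insert_erase hγ]
    rw [hunion, polymerPartitionFunction_insert inc_symm_of_symm w hγAB, hBγ,
      polymerPartitionFunction_insert inc_symm_of_symm w (Finset.notMem_erase γ B),
      Finset.erase_insert (Finset.notMem_erase γ B)]
    have hfilter : (A ∪ B.erase γ).filter (fun γ' => ¬ inc γ γ') =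
        A ∪ (B.erase γ).filter (fun γ' => ¬ inc γ γ') := by
      rw [Finset.filter_union, Finset.filter_true_of_mem]
      intro γ₁ hγ₁ h
      exact hAB γ₁ hγ₁ γ hγ (Std.Symm.symm _ _ h)
    have h1 : polymerPartitionFunction inc w (A ∪ B.erase γ) = polymerPartitionFunction inc w A * polymerPartitionFunction inc w (B.erase γ) :=
      ih _ (Finset.erase_ssubset hγ) (Finset.disjoint_of_subset_right (Finset.erase_subset _ _) hdisj)
        fun γ₁ hγ₁ γ₂ hγ₂ => hAB γ₁ hγ₁ γ₂ (Finset.mem_of_mem_erase hγ₂)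
    have h2 : polymerPartitionFunction inc w (A ∪ (B.erase γ).filter fun γ' => ¬ inc γ γ') =
        polymerPartitionFunction inc w A *
          polymerPartitionFunction inc w ((B.erase γ).filter fun γ' => ¬ inc γ γ') :=
      ih _ (Finset.ssubset_of_subset_of_ssubset (Finset.filter_subset _ _) (Finset.erase_ssubset hγ))
        (Finset.disjoint_of_subset_right ((Finset.filter_subset _ _).trans (Finset.erase_subset _ _))
          hdisj)
        fun γ₁ hγ₁ γ₂ hγ₂ => hAB γ₁ hγ₁ γ₂ (Finset.mem_of_mem_erase (Finset.mem_filter.1 hγ₂).1)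
    rw [hfilter, h1, h2]
    ring

/-- Continuity of `t ↦ Z(Λ; t • w)`. [folklore] -/
theorem continuous_polymerPartitionFunction_ray (w : P → ℂ) (Λ : Finset P) :
    Continuous fun s : ℝ => polymerPartitionFunction inc (fun γ => (s : ℂ) * w γ) Λ :=
  continuous_iff_continuousAt.2 fun s => (hasDerivAt_polymerPartitionFunction_ray w Λ s).continuousAt

omit [DecidableRel inc] in
/-- Continuity of the ray derivative. [folklore] -/
theorem continuous_polymerRayDeriv [DecidableRel inc] (w : P → ℂ) (Λ : Finset P) :
    Continuous (polymerRayDeriv inc w Λ) := by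
  unfold polymerRayDeriv; fun_prop

/-- The integrand of the KP logarithm is continuous on `[0, 1]` when `Z` does not vanish
there. [folklore] -/
theorem continuousOn_polymerLogZ_integrand {w : P → ℂ} {Λ : Finset P}
    (hZ : ∀ t ∈ Set.Icc (0 : ℝ) 1, polymerPartitionFunction inc (fun γ => (t : ℂ) * w γ) Λ ≠ 0) :
    ContinuousOn (fun t : ℝ => polymerRayDeriv inc w Λ t / polymerPartitionFunction inc (fun γ => (t : ℂ) * w γ) Λ)
      (Set.uIcc 0 1) := by
  rw [Set.uIcc_of_le zero_le_one]
  exact (continuous_polymerRayDeriv w Λ).continuousOn.div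
    (continuous_polymerPartitionFunction_ray w Λ).continuousOn hZ

/-- **Additivity of the KP logarithm over mutually compatible parts**: if `A`, `B` are
disjoint, mutually compatible, and `Z(A; t w)`, `Z(B; t w)` do not vanish for `t ∈ [0, 1]`, then
`log Z(A ∪ B) = log Z(A) + log Z(B)` (the logarithmic derivative of `Z(A) Z(B)` is the sum of
the logarithmic derivatives). [folklore] -/
theorem polymerLogZ_union_of_forall_not [Std.Symm inc] {w : P → ℂ} {A B : Finset P}
    (hdisj : Disjoint A B) (hAB : ∀ γ₁ ∈ A, ∀ γ₂ ∈ B, ¬ inc γ₁ γ₂)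
    (hA : ∀ t ∈ Set.Icc (0 : ℝ) 1, polymerPartitionFunction inc (fun γ => (t : ℂ) * w γ) A ≠ 0)
    (hB : ∀ t ∈ Set.Icc (0 : ℝ) 1, polymerPartitionFunction inc (fun γ => (t : ℂ) * w γ) B ≠ 0) :
    polymerLogZ inc w (A ∪ B) = polymerLogZ inc w A + polymerLogZ inc w B := by
  unfold polymerLogZ
  rw [← intervalIntegral.integral_add (continuousOn_polymerLogZ_integrand hA).intervalIntegrable
    (continuousOn_polymerLogZ_integrand hB).intervalIntegrable]
  refine intervalIntegral.integral_congr fun t ht => ?_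
  have ht' : t ∈ Set.Icc (0 : ℝ) 1 := by rwa [Set.uIcc_of_le zero_le_one] at ht
  have hderiv : polymerRayDeriv inc w (A ∪ B) t =
      polymerRayDeriv inc w A t * polymerPartitionFunction inc (fun γ => (t : ℂ) * w γ) B +
        polymerPartitionFunction inc (fun γ => (t : ℂ) * w γ) A * polymerRayDeriv inc w B t := by
    have h1 := hasDerivAt_polymerPartitionFunction_ray (inc := inc) w (A ∪ B) t
    have h2 := (hasDerivAt_polymerPartitionFunction_ray (inc := inc) w A t).mul (hasDerivAt_polymerPartitionFunction_ray (inc := inc) w B t)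
    have hfun : (fun s : ℝ => polymerPartitionFunction inc (fun γ => (s : ℂ) * w γ) (A ∪ B)) = fun s : ℝ =>
        polymerPartitionFunction inc (fun γ => (s : ℂ) * w γ) A * polymerPartitionFunction inc (fun γ => (s : ℂ) * w γ) B :=
      funext fun s => polymerPartitionFunction_union_of_forall_not _ hdisj hAB
    rw [hfun] at h1
    exact h1.unique h2
  rw [hderiv, polymerPartitionFunction_union_of_forall_not _ hdisj hAB]
  field_simp [hA t ht', hB t ht']

/-- The signed sum `∑_{B ⊆ C} (-1)^{|C ∖ B|} f(B ∩ C₁)` of a set function that only sees the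
part `C₁ ⊊ C` vanishes (the sum over the complementary part `C ∖ C₁ ≠ ∅` is an alternating sum
of binomial coefficients). [folklore] -/
theorem sum_powerset_neg_one_pow_mul_apply_inter_eq_zero {M : Type*} [CommRing M]
    (f : Finset P → M) {C C₁ : Finset P} (hC₁ : C₁ ⊆ C) (hC₂ : (C \ C₁).Nonempty) :
    ∑ B ∈ C.powerset, (-1 : M) ^ (C \ B).card * f (B ∩ C₁) = 0 := by
  -- reindex `B ↦ (B ∩ C₁, B \ C₁)`
  have hre : ∑ B ∈ C.powerset, (-1 : M) ^ (C \ B).card * f (B ∩ C₁) =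
      ∑ p ∈ C₁.powerset ×ˢ (C \ C₁).powerset,
        (-1 : M) ^ (C₁ \ p.1).card * f p.1 * (-1 : M) ^ ((C \ C₁) \ p.2).card := by
    refine Finset.sum_bij' (fun B _ => (B ∩ C₁, B \ C₁)) (fun p _ => p.1 ∪ p.2) ?_ ?_ ?_ ?_ ?_
    · intro B hB
      have hBC : B ⊆ C := Finset.mem_powerset.1 hB
      exact Finset.mem_product.2 ⟨Finset.mem_powerset.2 Finset.inter_subset_right,
        Finset.mem_powerset.2 (Finset.sdiff_subset_sdiff hBC Finset.Subset.rfl)⟩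
    · intro p hp
      obtain ⟨h1, h2⟩ := Finset.mem_product.1 hp
      exact Finset.mem_powerset.2 (Finset.union_subset ((Finset.mem_powerset.1 h1).trans hC₁)
        ((Finset.mem_powerset.1 h2).trans Finset.sdiff_subset))
    · intro B hB
      simp only
      rw [Finset.union_comm, Finset.sdiff_union_inter]
    · intro p hp
      obtain ⟨h1, h2⟩ := Finset.mem_product.1 hp
      have h1' : p.1 ⊆ C₁ := Finset.mem_powerset.1 h1
      have h2' : p.2 ⊆ C \ C₁ := Finset.mem_powerset.1 h2
      have hd2 : Disjoint p.2 C₁ := Finset.disjoint_of_subset_left h2' Finset.sdiff_disjoint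
      ext <;> simp only
      · rw [Finset.union_inter_distrib_right, Finset.inter_eq_left.2 h1',
          Finset.disjoint_iff_inter_eq_empty.1 hd2, Finset.union_empty]
      · rw [Finset.union_sdiff_distrib, Finset.sdiff_eq_empty_iff_subset.2 h1', Finset.empty_union,
          Finset.sdiff_eq_self_of_disjoint hd2]
    · intro B hB
      have hBC : B ⊆ C := Finset.mem_powerset.1 hB
      simp only
      -- `|C \ B| = |C₁ \ (B ∩ C₁)| + |(C \ C₁) \ (B \ C₁)|`
      have hsplit : C \ B = C₁ \ (B ∩ C₁) ∪ (C \ C₁) \ (B \ C₁) := by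
        ext γ
        simp only [Finset.mem_sdiff, Finset.mem_union, Finset.mem_inter]
        constructor
        · rintro ⟨hγC, hγB⟩
          by_cases hγ1 : γ ∈ C₁
          · exact Or.inl ⟨hγ1, fun h => hγB h.1⟩
          · exact Or.inr ⟨⟨hγC, hγ1⟩, fun h => hγB h.1⟩
        · rintro (⟨hγ1, hγB⟩ | ⟨⟨hγC, hγ1⟩, hγB⟩)
          · exact ⟨hC₁ hγ1, fun h => hγB ⟨h, hγ1⟩⟩
          · exact ⟨hγC, fun h => hγB ⟨h, hγ1⟩⟩
      have hdisj : Disjoint (C₁ \ (B ∩ C₁)) ((C \ C₁) \ (B \ C₁)) :=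
        Finset.disjoint_of_subset_left Finset.sdiff_subset
          (Finset.disjoint_of_subset_right Finset.sdiff_subset Finset.disjoint_sdiff)
      rw [hsplit, Finset.card_union_of_disjoint hdisj, pow_add]
      ring
  have hC₂sum : ∑ y ∈ (C \ C₁).powerset, (-1 : M) ^ ((C \ C₁) \ y).card = 0 := by
    have h := Finset.sum_pow_mul_eq_add_pow (1 : M) (-1) (C \ C₁)
    rw [add_neg_cancel, zero_pow (Finset.card_ne_zero.2 hC₂)] at h
    rw [← h]
    refine Finset.sum_congr rfl fun y hy => ?_
    rw [one_pow, one_mul, Finset.card_sdiff_of_subset (Finset.mem_powerset.1 hy)]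
  rw [hre, Finset.sum_product]
  simp_rw [← Finset.mul_sum]
  simp [hC₂sum]

/-- **The truncated functional lives on clusters** ([KP86, Theorem, last assertion]): if `C`
is not a cluster and the partition functions of the sub-volumes of `C` do not vanish along
the segment `t • w`, `t ∈ [0, 1]` (e.g. `C` is contained in a KP volume), then `Φ^T(C) = 0`.
Indeed, for a decomposition `C = C₁ ⊔ C₂` into mutually compatible non-empty parts,
`log Z(B) = log Z(B ∩ C₁) + log Z(B ∩ C₂)` for all `B ⊆ C`, and the Möbius transform of each
summand vanishes. [cite: KoteckyPreiss1986, Theorem p. 492 (last assertion)] -/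
theorem truncatedWeight_eq_zero_of_not_isPolymerCluster [Std.Symm inc] {w : P → ℂ}
    {C : Finset P}
    (hZ : ∀ B ⊆ C, ∀ t ∈ Set.Icc (0 : ℝ) 1, polymerPartitionFunction inc (fun γ => (t : ℂ) * w γ) B ≠ 0)
    (hC : ¬ IsPolymerCluster inc C) : truncatedWeight inc w C = 0 := by
  unfold IsPolymerCluster at hC
  push Not at hC
  obtain ⟨C₁, hC₁C, hC₁ne, hC₂ne, hcompat⟩ := hC
  -- additivity of `log Z` on every `B ⊆ C`
  have hadd : ∀ B ⊆ C, polymerLogZ inc w B =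
      polymerLogZ inc w (B ∩ (C \ C₁)) + polymerLogZ inc w (B ∩ C₁) := by
    intro B hB
    have hsplit : B = B ∩ (C \ C₁) ∪ B ∩ C₁ := by
      ext γ
      simp only [Finset.mem_union, Finset.mem_inter, Finset.mem_sdiff]
      constructor
      · intro hγ
        by_cases h1 : γ ∈ C₁
        · exact Or.inr ⟨hγ, h1⟩
        · exact Or.inl ⟨hγ, hB hγ, h1⟩
      · rintro (⟨hγ, -⟩ | ⟨hγ, -⟩) <;> exact hγ
    conv_lhs => rw [hsplit]
    refine polymerLogZ_union_of_forall_not ?_ ?_ (hZ _ (Finset.inter_subset_left.trans hB))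
      (hZ _ (Finset.inter_subset_left.trans hB))
    · exact Finset.disjoint_left.2 fun γ h1 h2 =>
        (Finset.mem_sdiff.1 (Finset.mem_inter.1 h1).2).2 (Finset.mem_inter.1 h2).2
    · intro γ₁ hγ₁ γ₂ hγ₂ h
      exact hcompat γ₂ (Finset.mem_inter.1 hγ₂).2 γ₁ (Finset.mem_inter.1 hγ₁).2
        (Std.Symm.symm _ _ h)
  unfold truncatedWeight
  rw [Finset.sum_congr rfl fun B hB => by rw [hadd B (Finset.mem_powerset.1 hB)]]
  simp only [mul_add, Finset.sum_add_distrib]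
  have hC₁' : (C \ (C \ C₁)).Nonempty := by rwa [Finset.sdiff_sdiff_eq_self hC₁C]
  rw [sum_powerset_neg_one_pow_mul_apply_inter_eq_zero (polymerLogZ inc w) Finset.sdiff_subset hC₁',
    sum_powerset_neg_one_pow_mul_apply_inter_eq_zero (polymerLogZ inc w) hC₁C hC₂ne, add_zero]

/-- In a KP volume the truncated functional vanishes off clusters. [cite: KoteckyPreiss1986, Theorem p. 492 (last assertion)] -/
theorem truncatedWeight_eq_zero_of_kp [Std.Refl inc] [Std.Symm inc] {w : P → ℂ} {a : P → ℝ} {Λ C : Finset P}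
    (hKP : IsKPVolume inc w a Λ) (hC : C ⊆ Λ) (hCl : ¬ IsPolymerCluster inc C) :
    truncatedWeight inc w C = 0 := by
  refine truncatedWeight_eq_zero_of_not_isPolymerCluster (fun B hB t ht => ?_) hCl
  have hKPt : IsKPVolume inc (fun γ => (t : ℂ) * w γ) a Λ := fun γ hγ => by
    refine le_trans (Finset.sum_le_sum fun γ' _ => ?_) (hKP γ hγ)
    unfold kpTerm
    refine mul_le_mul_of_nonneg_right ?_ (Real.exp_nonneg _)
    rw [norm_mul, Complex.norm_real, Real.norm_eq_abs, abs_of_nonneg ht.1]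
    exact mul_le_of_le_one_left (norm_nonneg _) ht.2
  exact polymerPartitionFunction_ne_zero_of_kp hKPt (hB.trans hC)

omit [DecidableEq P] in
/-- The global Kotecký–Preiss condition (1) of [KP86] (with `d ≥ 0`) implies the finite-volume
condition on every finite volume. [cite: KoteckyPreiss1986, (1)] -/
theorem isKPVolume_of_tsum_le {w : P → ℂ} {a d : P → ℝ} (hd : ∀ γ, 0 ≤ d γ)
    (h1 : ∀ γ, Summable (fun γ' : {γ' : P // inc γ' γ} =>
        ‖w γ'‖ * Real.exp (a γ' + d γ')) ∧
      ∑' γ' : {γ' : P // inc γ' γ}, ‖w γ'‖ * Real.exp (a γ' + d γ') ≤ a γ)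
    (Λ : Finset P) : IsKPVolume inc w a Λ := by
  intro γ _
  obtain ⟨hs, hle⟩ := h1 γ
  refine le_trans ?_ hle
  -- the finite sum over `Λ.filter (· ι γ)` is a partial sum of the series over `{γ' // γ' ι γ}`
  set S : Finset P := Λ.filter fun γ' => inc γ' γ with hS
  have hSι : ∀ γ' ∈ S, inc γ' γ := fun γ' hγ' => (Finset.mem_filter.1 hγ').2
  set S' : Finset {γ' : P // inc γ' γ} := S.attach.map
    ⟨fun x => ⟨x.1, hSι x.1 x.2⟩, fun x y hxy => by
      simp only [Subtype.mk.injEq] at hxy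
      exact Subtype.ext hxy⟩ with hS'
  calc ∑ γ' ∈ S, kpTerm w a γ'
      = ∑ x ∈ S', kpTerm w a (x : P) := by
        rw [hS', Finset.sum_map, ← Finset.sum_attach S]
        rfl
    _ ≤ ∑ x ∈ S', ‖w (x : P)‖ * Real.exp (a x + d x) := Finset.sum_le_sum fun x _ => by
        unfold kpTerm
        exact mul_le_mul_of_nonneg_left (Real.exp_le_exp.2 (le_add_of_nonneg_right (hd _)))
          (norm_nonneg _)
    _ ≤ ∑' γ' : {γ' : P // inc γ' γ}, ‖w γ'‖ * Real.exp (a γ' + d γ') :=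
        hs.sum_le_tsum S' fun x _ => mul_nonneg (norm_nonneg _) (Real.exp_nonneg _)

/-- **NAMED FACT — the Kotecký–Preiss cluster-expansion estimate** ([KP86, Theorem, p. 492,
estimate (4)]). Let `P` be a countable set of polymers with a reflexive and symmetric
incompatibility relation `inc` (`ι` of [KP86]), `w : P → ℂ` activities
(the polymer functional `Φ` of [KP86]), and `a, d : P → [0, ∞)` such that (1)
`∑_{γ' ι γ} e^{a(γ') + d(γ')} |w(γ')| ≤ a(γ)` for every `γ ∈ P`. Then the truncated
functional `Φ^T` of (3) (`truncatedWeight`, the Möbius transform of the branch `polymerLogZ`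
of `log Z`) satisfies, for every polymer `γ`, the estimate (4)
`∑_{C ι γ} |Φ^T(C)| e^{d(C)} ≤ a(γ)`, `d(C) = ∑_{γ' ∈ C} d(γ')`, the sum over all finite sets of
polymers `C` incompatible with `γ` being (absolutely) convergent. The other assertions of the
Theorem are proved in this file: zero-freeness `polymerPartitionFunction_ne_zero_of_kp` (via
`isKPVolume_of_tsum_le`), the logarithm property `exp_polymerLogZ_of_kp`, the expansion (2)
`polymerLogZ_eq_sum_truncatedWeight`, and the cluster support `truncatedWeight_eq_zero_of_kp`.
[cite: KoteckyPreiss1986, Theorem p. 492, estimate (4)] -/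
def koteckyPreiss_truncatedWeight_bound [Countable P] (inc : P → P → Prop) [DecidableRel inc]
    [Std.Refl inc] [Std.Symm inc] (w : P → ℂ) (a d : P → ℝ) : Prop :=
  (∀ γ, 0 ≤ a γ) → (∀ γ, 0 ≤ d γ) →
    (∀ γ, Summable (fun γ' : {γ' : P // inc γ' γ} =>
        ‖w γ'‖ * Real.exp (a γ' + d γ')) ∧
      ∑' γ' : {γ' : P // inc γ' γ}, ‖w γ'‖ * Real.exp (a γ' + d γ') ≤ a γ) →
    ∀ γ, Summable (fun C : {C : Finset P // KPTouches inc C γ} =>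
        ‖truncatedWeight inc w C‖ * Real.exp (∑ γ' ∈ (C : Finset P), d γ')) ∧
      ∑' C : {C : Finset P // KPTouches inc C γ},
        ‖truncatedWeight inc w C‖ * Real.exp (∑ γ' ∈ (C : Finset P), d γ') ≤ a γ

/-- **Ratios of partition functions through clusters** ([KP86, (5)]): in a KP volume `Λ`,
removing the polymers of `D ⊆ Λ` gives
`Z(Λ ∖ D)/Z(Λ) = exp (-∑_{C ⊆ Λ, C ∩ D ≠ ∅} Φ^T(C))` — by (2) for `Λ` and `Λ ∖ D` and the
logarithm property. (general form of [KP86, (5)], which is the special case of the polymers incompatible with a fixed compatible family) [cite: KoteckyPreiss1986, (5)] -/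
theorem polymerPartitionFunction_sdiff_div_eq_exp [Std.Refl inc] [Std.Symm inc] {w : P → ℂ} {a : P → ℝ} {Λ D : Finset P}
    (hKP : IsKPVolume inc w a Λ) :
    polymerPartitionFunction inc w (Λ \ D) / polymerPartitionFunction inc w Λ =
      Complex.exp (-∑ C ∈ Λ.powerset with (C ∩ D).Nonempty, truncatedWeight inc w C) := by
  have h1 := exp_polymerLogZ_of_kp hKP (Finset.sdiff_subset (s := Λ) (t := D))
  have h2 := exp_polymerLogZ_of_kp hKP (Finset.Subset.refl Λ)
  rw [← h1, ← h2, ← Complex.exp_sub, polymerLogZ_eq_sum_truncatedWeight,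
    polymerLogZ_eq_sum_truncatedWeight]
  congr 1
  rw [← Finset.sum_filter_add_sum_filter_not Λ.powerset (fun C => (C ∩ D).Nonempty)]
  have hset : Λ.powerset.filter (fun C => ¬ (C ∩ D).Nonempty) = (Λ \ D).powerset := by
    ext C
    simp only [Finset.mem_filter, Finset.mem_powerset, Finset.not_nonempty_iff_eq_empty,
      Finset.subset_sdiff, Finset.disjoint_iff_inter_eq_empty]
  rw [hset]
  ring

/-- A non-negative function summed over the sets meeting `D` is at most the sum over `γ ∈ D`
of its sums over the sets containing `γ`. [folklore] -/
theorem sum_filter_inter_nonempty_le_sum_sum {𝒞 : Finset (Finset P)} {D : Finset P}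
    {g : Finset P → ℝ} (hg : ∀ C, 0 ≤ g C) :
    ∑ C ∈ 𝒞 with (C ∩ D).Nonempty, g C ≤ ∑ γ ∈ D, ∑ C ∈ 𝒞 with γ ∈ C, g C := by
  calc ∑ C ∈ 𝒞 with (C ∩ D).Nonempty, g C
      ≤ ∑ C ∈ 𝒞 with (C ∩ D).Nonempty, ∑ γ ∈ D with γ ∈ C, g C := by
        refine Finset.sum_le_sum fun C hC => ?_
        rw [Finset.sum_const, nsmul_eq_mul]
        obtain ⟨γ, hγ⟩ := (Finset.mem_filter.1 hC).2
        have hpos : (1 : ℝ) ≤ (D.filter fun γ => γ ∈ C).card := by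
          exact_mod_cast Finset.card_pos.2 ⟨γ, Finset.mem_filter.2
            ⟨(Finset.mem_inter.1 hγ).2, (Finset.mem_inter.1 hγ).1⟩⟩
        nlinarith [hg C]
    _ = ∑ γ ∈ D, ∑ C ∈ (𝒞.filter fun C => (C ∩ D).Nonempty) with γ ∈ C, g C := by
        rw [Finset.sum_comm' (t' := D)
          (s' := fun γ => (𝒞.filter fun C => (C ∩ D).Nonempty).filter fun C => γ ∈ C)]
        intro C γ
        simp only [Finset.mem_filter]
        tauto
    _ ≤ ∑ γ ∈ D, ∑ C ∈ 𝒞 with γ ∈ C, g C := Finset.sum_le_sum fun γ _ =>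
        Finset.sum_le_sum_of_subset_of_nonneg (fun C hC => by
          simp only [Finset.mem_filter] at hC ⊢
          exact ⟨hC.1.1, hC.2⟩) fun C _ _ => hg C

/-- From the Kotecký–Preiss estimate (4): the truncated functionals of any finite family of
sets of polymers containing a fixed polymer `γ` have total size at most `a(γ)`; more precisely
`∑_{C ∈ 𝒞, γ ∈ C} ‖Φ^T(C)‖ e^{d(C)} ≤ a(γ)`. [cite: KoteckyPreiss1986, Theorem p. 492, estimate (4)] -/
theorem sum_norm_truncatedWeight_mul_exp_le [Countable P] [Std.Refl inc] [Std.Symm inc] {w : P → ℂ}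
    {a d : P → ℝ} (hfact : koteckyPreiss_truncatedWeight_bound inc w a d) (ha : ∀ γ, 0 ≤ a γ)
    (hd : ∀ γ, 0 ≤ d γ)
    (h1 : ∀ γ, Summable (fun γ' : {γ' : P // inc γ' γ} =>
        ‖w γ'‖ * Real.exp (a γ' + d γ')) ∧
      ∑' γ' : {γ' : P // inc γ' γ}, ‖w γ'‖ * Real.exp (a γ' + d γ') ≤ a γ)
    (𝒞 : Finset (Finset P)) (γ : P) :
    ∑ C ∈ 𝒞 with γ ∈ C, ‖truncatedWeight inc w C‖ * Real.exp (∑ γ' ∈ C, d γ') ≤ a γ := by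
  obtain ⟨hs, hle⟩ := hfact ha hd h1 γ
  refine le_trans ?_ hle
  set S : Finset (Finset P) := 𝒞.filter fun C => γ ∈ C with hS
  have hSι : ∀ C ∈ S, KPTouches inc C γ := fun C hC =>
    ⟨γ, (Finset.mem_filter.1 hC).2, Std.Refl.refl γ⟩
  set S' : Finset {C : Finset P // KPTouches inc C γ} := S.attach.map
    ⟨fun x => ⟨x.1, hSι x.1 x.2⟩, fun x y hxy => by
      simp only [Subtype.mk.injEq] at hxy
      exact Subtype.ext hxy⟩ with hS'
  calc ∑ C ∈ S, ‖truncatedWeight inc w C‖ * Real.exp (∑ γ' ∈ C, d γ')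
      = ∑ x ∈ S', ‖truncatedWeight inc w (x : Finset P)‖ *
          Real.exp (∑ γ' ∈ (x : Finset P), d γ') := by
        rw [hS', Finset.sum_map, ← Finset.sum_attach S]
        rfl
    _ ≤ ∑' C : {C : Finset P // KPTouches inc C γ},
          ‖truncatedWeight inc w C‖ * Real.exp (∑ γ' ∈ (C : Finset P), d γ') :=
        hs.sum_le_tsum S' fun x _ => mul_nonneg (norm_nonneg _) (Real.exp_nonneg _)

/-- From the Kotecký–Preiss estimate (4): in a KP system the cluster sum governing the ratio
`Z(Λ ∖ D)/Z(Λ)` is bounded by `∑_{γ ∈ D} a(γ)`, uniformly in the volume ([KP86, Proposition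
(i)]-type bound). [cite: KoteckyPreiss1986, Proposition p. 494 (i)] -/
theorem norm_sum_truncatedWeight_le [Countable P] [Std.Refl inc] [Std.Symm inc] {w : P → ℂ} {a d : P → ℝ}
    (hfact : koteckyPreiss_truncatedWeight_bound inc w a d) (ha : ∀ γ, 0 ≤ a γ)
    (hd : ∀ γ, 0 ≤ d γ)
    (h1 : ∀ γ, Summable (fun γ' : {γ' : P // inc γ' γ} =>
        ‖w γ'‖ * Real.exp (a γ' + d γ')) ∧
      ∑' γ' : {γ' : P // inc γ' γ}, ‖w γ'‖ * Real.exp (a γ' + d γ') ≤ a γ)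
    (𝒞 : Finset (Finset P)) (D : Finset P) :
    ‖∑ C ∈ 𝒞 with (C ∩ D).Nonempty, truncatedWeight inc w C‖ ≤ ∑ γ ∈ D, a γ := by
  refine (norm_sum_le _ _).trans ?_
  refine (sum_filter_inter_nonempty_le_sum_sum (g := fun C => ‖truncatedWeight inc w C‖)
    fun C => norm_nonneg _).trans (Finset.sum_le_sum fun γ _ => ?_)
  refine le_trans (Finset.sum_le_sum fun C _ => ?_)
    (sum_norm_truncatedWeight_mul_exp_le hfact ha hd h1 𝒞 γ)
  exact le_mul_of_one_le_right (norm_nonneg _)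
    (Real.one_le_exp (Finset.sum_nonneg fun γ' _ => hd γ'))

/-- From the Kotecký–Preiss estimate (4): the clusters containing `γ` of `d`-size at least `r`
have total truncated weight at most `e^{-r} a(γ)` (the tail bound behind [KP86, Proposition
(ii)–(iv)]). [cite: KoteckyPreiss1986, Theorem p. 492, estimate (4)] -/
theorem sum_norm_truncatedWeight_le_exp_neg_mul [Countable P] [Std.Refl inc] [Std.Symm inc] {w : P → ℂ}
    {a d : P → ℝ} (hfact : koteckyPreiss_truncatedWeight_bound inc w a d) (ha : ∀ γ, 0 ≤ a γ)
    (hd : ∀ γ, 0 ≤ d γ)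
    (h1 : ∀ γ, Summable (fun γ' : {γ' : P // inc γ' γ} =>
        ‖w γ'‖ * Real.exp (a γ' + d γ')) ∧
      ∑' γ' : {γ' : P // inc γ' γ}, ‖w γ'‖ * Real.exp (a γ' + d γ') ≤ a γ)
    (𝒞 : Finset (Finset P)) (γ : P) {r : ℝ} (hr : ∀ C ∈ 𝒞, γ ∈ C → r ≤ ∑ γ' ∈ C, d γ') :
    ∑ C ∈ 𝒞 with γ ∈ C, ‖truncatedWeight inc w C‖ ≤ Real.exp (-r) * a γ := by
  have h := sum_norm_truncatedWeight_mul_exp_le hfact ha hd h1 𝒞 γ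
  rw [Real.exp_neg, ← div_eq_inv_mul, le_div_iff₀ (Real.exp_pos r), Finset.sum_mul]
  refine le_trans (Finset.sum_le_sum fun C hC => ?_) h
  exact mul_le_mul_of_nonneg_left (Real.exp_le_exp.2 (hr C (Finset.mem_filter.1 hC).1
    (Finset.mem_filter.1 hC).2)) (norm_nonneg _)

end ClusterExpansion

omit [DecidableEq P] in
/-- For a finite polymer set, the global Kotecký–Preiss hypothesis (1) of [KP86] in the form used
by `koteckyPreiss_truncatedWeight_bound` is a finite-sum condition. [cite: KoteckyPreiss1986, (1)] -/
theorem kp_hypothesis_of_fintype [Fintype P] {w : P → ℂ} {a d : P → ℝ}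
    (h : ∀ γ, ∑ γ' ∈ Finset.univ with inc γ' γ, ‖w γ'‖ * Real.exp (a γ' + d γ') ≤ a γ)
    (γ : P) :
    Summable (fun γ' : {γ' : P // inc γ' γ} => ‖w γ'‖ * Real.exp (a γ' + d γ')) ∧
      ∑' γ' : {γ' : P // inc γ' γ}, ‖w γ'‖ * Real.exp (a γ' + d γ') ≤ a γ := by
  refine ⟨Summable.of_finite, ?_⟩
  rw [tsum_fintype, ← Finset.sum_subtype (Finset.univ.filter fun γ' => inc γ' γ)
    (fun γ' => by rw [Finset.mem_filter]; simp) (fun γ' => ‖w γ'‖ * Real.exp (a γ' + d γ'))]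
  exact h γ

/-! ### Relabeling invariance

The partition function, the KP logarithm and the truncated functional of a finite volume only
depend on the isomorphism class of the finite polymer system (activities and compatibility on
the volume): they are invariant under injective relabelings. This is what identifies clusters of
different tori / of `ℤ^d` in thermodynamic limits. -/

section Relabel

variable {P' : Type*} [DecidableEq P'] {inc' : P' → P' → Prop} [DecidableRel inc']

omit [DecidableEq P] [DecidableRel inc] [DecidableRel inc'] in
/-- Compatibility is transported by a relabeling respecting incompatibility. [folklore] -/
theorem isCompatible_image_iff {φ : P → P'} {X : Finset P} (hφ : Set.InjOn φ X)
    (hR : ∀ a ∈ X, ∀ b ∈ X, (inc' (φ a) (φ b) ↔ inc a b)) :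
    IsCompatible inc' (X.image φ) ↔ IsCompatible inc X := by
  rw [isCompatible_iff, isCompatible_iff]
  constructor
  · intro h a ha b hb hab h'
    exact h _ (Finset.mem_image_of_mem φ ha) _ (Finset.mem_image_of_mem φ hb)
      (fun h'' => hab (hφ ha hb h'')) ((hR a ha b hb).2 h')
  · intro h a' ha' b' hb' hab' h'
    obtain ⟨a, ha, rfl⟩ := Finset.mem_image.1 ha'
    obtain ⟨b, hb, rfl⟩ := Finset.mem_image.1 hb'
    exact h a ha b hb (fun h'' => hab' (h'' ▸ rfl)) ((hR a ha b hb).1 h')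

/-- **Relabeling invariance of the partition function.** [folklore] -/
theorem polymerPartitionFunction_image {φ : P → P'} {w : P → ℂ} {w' : P' → ℂ}
    {Λ : Finset P} (hφ : Set.InjOn φ Λ) (hR : ∀ a ∈ Λ, ∀ b ∈ Λ, (inc' (φ a) (φ b) ↔ inc a b))
    (hw : ∀ a ∈ Λ, w' (φ a) = w a) :
    polymerPartitionFunction inc' w' (Λ.image φ) = polymerPartitionFunction inc w Λ := by
  unfold polymerPartitionFunction
  rw [Finset.powerset_image, Finset.sum_image]
  · refine Finset.sum_congr rfl fun X hX => ?_
    have hXΛ : X ⊆ Λ := Finset.mem_powerset.1 hX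
    have hiff := isCompatible_image_iff (inc := inc) (inc' := inc') (hφ.mono (Finset.coe_subset.2 hXΛ))
      (fun a ha b hb => hR a (hXΛ ha) b (hXΛ hb))
    by_cases hc : IsCompatible inc X
    · rw [if_pos (hiff.2 hc), if_pos hc,
        Finset.prod_image fun a ha b hb h => (hφ.mono (Finset.coe_subset.2 hXΛ)) ha hb h]
      exact Finset.prod_congr rfl fun a ha => hw a (hXΛ ha)
    · rw [if_neg (fun h => hc (hiff.1 h)), if_neg hc]
  · intro X hX Y hY hXY
    rw [Finset.mem_coe, Finset.mem_powerset] at hX hY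
    exact (Finset.image_eq_image_iff_of_injOn hφ hX hY).1 hXY

/-- **Relabeling invariance of the ray derivative.** [folklore] -/
theorem polymerRayDeriv_image {φ : P → P'} {w : P → ℂ} {w' : P' → ℂ}
    {Λ : Finset P} (hφ : Set.InjOn φ Λ) (hR : ∀ a ∈ Λ, ∀ b ∈ Λ, (inc' (φ a) (φ b) ↔ inc a b))
    (hw : ∀ a ∈ Λ, w' (φ a) = w a) (t : ℝ) :
    polymerRayDeriv inc' w' (Λ.image φ) t = polymerRayDeriv inc w Λ t := by
  unfold polymerRayDeriv
  rw [Finset.sum_filter, Finset.sum_filter, Finset.powerset_image, Finset.sum_image]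
  · refine Finset.sum_congr rfl fun X hX => ?_
    have hXΛ : X ⊆ Λ := Finset.mem_powerset.1 hX
    have hφX : Set.InjOn φ X := hφ.mono (Finset.coe_subset.2 hXΛ)
    have hiff := isCompatible_image_iff (inc := inc) (inc' := inc') hφX
      (fun a ha b hb => hR a (hXΛ ha) b (hXΛ hb))
    by_cases hc : IsCompatible inc X
    · rw [if_pos (hiff.2 hc), if_pos hc, Finset.card_image_of_injOn hφX,
        Finset.prod_image fun a ha b hb h => hφX ha hb h]
      rw [Finset.prod_congr rfl fun a ha => hw a (hXΛ ha)]
    · rw [if_neg (fun h => hc (hiff.1 h)), if_neg hc]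
  · intro X hX Y hY hXY
    rw [Finset.mem_coe, Finset.mem_powerset] at hX hY
    exact (Finset.image_eq_image_iff_of_injOn hφ hX hY).1 hXY

/-- **Relabeling invariance of the Kotecký–Preiss logarithm.** [folklore] -/
theorem polymerLogZ_image {φ : P → P'} {w : P → ℂ} {w' : P' → ℂ}
    {Λ : Finset P} (hφ : Set.InjOn φ Λ) (hR : ∀ a ∈ Λ, ∀ b ∈ Λ, (inc' (φ a) (φ b) ↔ inc a b))
    (hw : ∀ a ∈ Λ, w' (φ a) = w a) :
    polymerLogZ inc' w' (Λ.image φ) = polymerLogZ inc w Λ := by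
  unfold polymerLogZ
  refine intervalIntegral.integral_congr fun t _ => ?_
  rw [polymerRayDeriv_image hφ hR hw,
    polymerPartitionFunction_image (w := fun γ => (t : ℂ) * w γ) (w' := fun γ => (t : ℂ) * w' γ) hφ hR
      (fun a ha => by rw [hw a ha])]

/-- **Relabeling invariance of the truncated functional**: `Φ^T(C)` only depends on the
isomorphism class of the finite polymer system `C` (activities and compatibility on `C`).
[folklore] -/
theorem truncatedWeight_image {φ : P → P'} {w : P → ℂ} {w' : P' → ℂ}
    {C : Finset P} (hφ : Set.InjOn φ C) (hR : ∀ a ∈ C, ∀ b ∈ C, (inc' (φ a) (φ b) ↔ inc a b))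
    (hw : ∀ a ∈ C, w' (φ a) = w a) :
    truncatedWeight inc' w' (C.image φ) = truncatedWeight inc w C := by
  unfold truncatedWeight
  rw [Finset.powerset_image, Finset.sum_image]
  · refine Finset.sum_congr rfl fun B hB => ?_
    have hBC : B ⊆ C := Finset.mem_powerset.1 hB
    have hφB : Set.InjOn φ B := hφ.mono (Finset.coe_subset.2 hBC)
    rw [polymerLogZ_image hφB (fun a ha b hb => hR a (hBC ha) b (hBC hb)) (fun a ha => hw a (hBC ha))]
    congr 2
    rw [← Finset.image_sdiff_of_injOn hφ hBC, Finset.card_image_of_injOn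
      (hφ.mono (Finset.coe_subset.2 Finset.sdiff_subset))]
  · intro X hX Y hY hXY
    rw [Finset.mem_coe, Finset.mem_powerset] at hX hY
    exact (Finset.image_eq_image_iff_of_injOn hφ hX hY).1 hXY

end Relabel

/-! ## Consequences of the Kotecký–Preiss estimate in `KPTouches` form -/

section TouchesBounds

/-- From the Kotecký–Preiss estimate (4): for any finite family of finite sets of polymers, the
part touching a fixed polymer `σ` has `∑ ‖Φ^T(C)‖ e^{d(C)} ≤ a(σ)`. [cite: KoteckyPreiss1986, Theorem p. 492, estimate (4)] -/
theorem sum_norm_truncatedWeight_mul_exp_le_of_touches [Countable P] [Std.Refl inc] [Std.Symm inc] {w : P → ℂ}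
    {a d : P → ℝ} (hfact : koteckyPreiss_truncatedWeight_bound inc w a d) (ha : ∀ γ, 0 ≤ a γ)
    (hd : ∀ γ, 0 ≤ d γ)
    (h1 : ∀ γ, Summable (fun γ' : {γ' : P // inc γ' γ} =>
        ‖w γ'‖ * Real.exp (a γ' + d γ')) ∧
      ∑' γ' : {γ' : P // inc γ' γ}, ‖w γ'‖ * Real.exp (a γ' + d γ') ≤ a γ)
    (𝒞 : Finset (Finset P)) (σ : P) [DecidablePred fun C : Finset P => KPTouches inc C σ] :
    ∑ C ∈ 𝒞 with KPTouches inc C σ, ‖truncatedWeight inc w C‖ * Real.exp (∑ γ' ∈ C, d γ') ≤ a σ := by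
  obtain ⟨hs, hle⟩ := hfact ha hd h1 σ
  refine le_trans ?_ hle
  set S : Finset (Finset P) := 𝒞.filter fun C => KPTouches inc C σ with hS
  have hSι : ∀ C ∈ S, KPTouches inc C σ := fun C hC => (Finset.mem_filter.1 hC).2
  set S' : Finset {C : Finset P // KPTouches inc C σ} := S.attach.map
    ⟨fun x => ⟨x.1, hSι x.1 x.2⟩, fun x y hxy => by
      simp only [Subtype.mk.injEq] at hxy
      exact Subtype.ext hxy⟩ with hS'
  calc ∑ C ∈ S, ‖truncatedWeight inc w C‖ * Real.exp (∑ γ' ∈ C, d γ')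
      = ∑ x ∈ S', ‖truncatedWeight inc w (x : Finset P)‖ *
          Real.exp (∑ γ' ∈ (x : Finset P), d γ') := by
        rw [hS', Finset.sum_map, ← Finset.sum_attach S]
        rfl
    _ ≤ ∑' C : {C : Finset P // KPTouches inc C σ},
          ‖truncatedWeight inc w C‖ * Real.exp (∑ γ' ∈ (C : Finset P), d γ') :=
        hs.sum_le_tsum S' fun x _ => mul_nonneg (norm_nonneg _) (Real.exp_nonneg _)

/-- From (4): the sets touching `σ` with `d`-size at least `r` weigh at most `e^{-r} a(σ)`.
[cite: KoteckyPreiss1986, Theorem p. 492, estimate (4)] -/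
theorem sum_norm_truncatedWeight_le_exp_neg_of_touches [Countable P] [Std.Refl inc] [Std.Symm inc] {w : P → ℂ}
    {a d : P → ℝ} (hfact : koteckyPreiss_truncatedWeight_bound inc w a d) (ha : ∀ γ, 0 ≤ a γ)
    (hd : ∀ γ, 0 ≤ d γ)
    (h1 : ∀ γ, Summable (fun γ' : {γ' : P // inc γ' γ} =>
        ‖w γ'‖ * Real.exp (a γ' + d γ')) ∧
      ∑' γ' : {γ' : P // inc γ' γ}, ‖w γ'‖ * Real.exp (a γ' + d γ') ≤ a γ)
    (𝒞 : Finset (Finset P)) (σ : P) [DecidablePred fun C : Finset P => KPTouches inc C σ] {r : ℝ}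
    (hr : ∀ C ∈ 𝒞, KPTouches inc C σ → r ≤ ∑ γ' ∈ C, d γ') :
    ∑ C ∈ 𝒞 with KPTouches inc C σ, ‖truncatedWeight inc w C‖ ≤ Real.exp (-r) * a σ := by
  have h := sum_norm_truncatedWeight_mul_exp_le_of_touches hfact ha hd h1 𝒞 σ
  rw [Real.exp_neg, ← div_eq_inv_mul, le_div_iff₀ (Real.exp_pos r), Finset.sum_mul]
  refine le_trans (Finset.sum_le_sum fun C hC => ?_) h
  exact mul_le_mul_of_nonneg_left (Real.exp_le_exp.2 (hr C (Finset.mem_filter.1 hC).1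
    (Finset.mem_filter.1 hC).2)) (norm_nonneg _)

/-- From (4): the sets touching `σ` weigh at most `a(σ)`.
[cite: KoteckyPreiss1986, Theorem p. 492, estimate (4)] -/
theorem sum_norm_truncatedWeight_le_of_touches [Countable P] [Std.Refl inc] [Std.Symm inc] {w : P → ℂ}
    {a d : P → ℝ} (hfact : koteckyPreiss_truncatedWeight_bound inc w a d) (ha : ∀ γ, 0 ≤ a γ)
    (hd : ∀ γ, 0 ≤ d γ)
    (h1 : ∀ γ, Summable (fun γ' : {γ' : P // inc γ' γ} =>
        ‖w γ'‖ * Real.exp (a γ' + d γ')) ∧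
      ∑' γ' : {γ' : P // inc γ' γ}, ‖w γ'‖ * Real.exp (a γ' + d γ') ≤ a γ)
    (𝒞 : Finset (Finset P)) (σ : P) [DecidablePred fun C : Finset P => KPTouches inc C σ] :
    ∑ C ∈ 𝒞 with KPTouches inc C σ, ‖truncatedWeight inc w C‖ ≤ a σ := by
  have h := sum_norm_truncatedWeight_le_exp_neg_of_touches hfact ha hd h1 𝒞 σ (r := 0)
    (fun C _ _ => Finset.sum_nonneg fun γ' _ => hd γ')
  simpa using h

end TouchesBounds



end Literature.Probability.LatticeModels
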